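import Summits.Ventures.Crystal3D.Theorems.StickyWulffConstantTextureBuildHealCut
import HarnessLib

/-!
# TB-1 brick L-HEAL, surgery form: occupy a prescribed finite set of lattice sites — remove the blocking junk, refill the vacant ones — with the exact bill
# (lane T, crux `TextureLiminfV5`, stmt-Ventures-23912; memo HOME/wulff-p2/g24/HEAL-g24.md §3 «aggressive healing up to the interface»)

HONEST FRAMING. Venture `Summits/Ventures/Crystal3D` (cell `crystal3d-full`), route `route-Ventures-StickyWulffConstant`, helper `--supports` the
law-v5 crux `TextureLiminfV5` (stmt-Ventures-23912).  Pure finite combinatorics over '…TextureBuildHealCut' (census-free, standard axioms).  Nothing about any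
cover or texture is claimed; F-C1 not moved.

WHY.  A wall cell of the TB-cover needs its two plate windows COMPLETE; the constructor therefore wants, for a prescribed finite set `W` of sites of the grain
lattice `S` (the plate window under a disc, with a margin), a healed packing in which EVERY site of `W` is a ball, with a deficiency bill it can pay and a
ball count it can afford.  '…HealCut' priced an arbitrary surgery `X ↦ (X ∖ R) ∪ V` when the kept balls touching the removed junk are lattice balls; at the
wall end of an attached feature the cut also severs junk–junk contacts, so this file first drops that hypothesis:

* `crossCount_removed_le_general` — kissing bound with NO hypothesis on the kept balls: `cross(K, R) ≤ cross(K, V) + Σ_{b ∈ K ∩ S touching R} #abandoned(b)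
  + cross(K ∖ S, R)` (the last term = junk–junk contacts severed by the cut);
* **`contactDeficiency_cut_heal_le_general`** — `D(K ∪ V) ≤ D(X) − hd_X(R) + ½·(Σ_{V} #abandoned + Σ_{K ∩ S touching R} #abandoned + cross(K ∖ S, R))`;
* **`exists_site_heal`** — THE SITE SURGERY, labelled: `x` a unit packing, `S` a moved Barlow stacking, `W ⊆ S` finite; `R` := the off-lattice balls within
  distance `< 1` of a site of `W` (the BLOCKERS), `V` := the vacant sites of `W`.  Then `(range x ∖ R) ∪ V` is a unit packing `x'` in which every site of
  `W` is a ball, `range x'` is described exactly, `N ≤ N' + #R` (only blockers are lost — off-lattice balls, hence `≤ #D`-many in the constructor), and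
  `6N' − b(x') ≤ 6N − b(x) − hd(R) + ½·(cut terms)`, the cut terms being abandoned adjacencies (touching `S`-sites still vacant AFTER the surgery,
  `abandoned_eq_vacant_after`) at refilled sites and at kept lattice balls that touched a blocker, plus severed junk–junk contacts.
In the constructor the cut terms live within `1` of `∂W`: zero on the grain side (complete material), `O(cross-section)` where an attached feature is cut.
-/

noncomputable section

namespace Summit.Ventures.Crystal3D.Theorems

open Finset Summit.Ventures.Crystal3D
open Literature.MathematicalPhysics.StatisticalMechanics (IsHaggSeq contactDeficiency)
open Summit.Ventures.Crystal3D.Cruxes.TextureLiminf.TexShadow (E3 stacking one_le_dist_of_mem_stacking)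

section General

variable {L : E3 ≃ₗᵢ[ℝ] E3} {s : E3} {σ : ℤ → ℤ} {X R V : Finset E3}

open scoped Classical in
/-- **KISSING BOUND, general form**: `cross(K, R) ≤ cross(K, V) + Σ_{b ∈ K, b ∈ S, b touching R} #abandoned(b) + cross(K ∖ S, R)` for a packing `X`,
`R ⊆ X`, `K = X ∖ R` — no hypothesis on the kept balls; the off-lattice ones contribute their severed contacts. -/
theorem crossCount_removed_le_general (hσ : IsHaggSeq σ) (hX : ∀ p ∈ X, ∀ q ∈ X, p ≠ q → 1 ≤ dist p q) (hR : R ⊆ X) (V : Finset E3) :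
    (crossCount (X \ R) R : ℝ) ≤ (crossCount (X \ R) V : ℝ) +
      ∑ b ∈ (X \ R).filter (fun b => b ∈ stacking L s σ ∧ ∃ a ∈ R, dist b a = 1), (abandoned (stacking L s σ) (X \ R) V b : ℝ) +
      (crossCount ((X \ R).filter fun b => b ∉ stacking L s σ) R : ℝ) := by
  classical
  set K : Finset E3 := X \ R with hKdef
  rw [crossCount_eq_sum K R, crossCount_eq_sum K V, crossCount_eq_sum (K.filter fun b => b ∉ stacking L s σ) R, Nat.cast_sum, Nat.cast_sum, Nat.cast_sum,
    Finset.sum_filter, Finset.sum_filter, ← Finset.sum_add_distrib, ← Finset.sum_add_distrib]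
  refine Finset.sum_le_sum fun b hb => ?_
  have hKX : K ⊆ X := Finset.sdiff_subset
  have hXK : X \ K = R := by rw [hKdef, Finset.sdiff_sdiff_eq_self hR]
  by_cases hbS : b ∈ stacking L s σ
  · rw [if_neg (not_not.2 hbS), add_zero]
    by_cases htouch : ∃ a ∈ R, dist b a = 1
    · rw [if_pos ⟨hbS, htouch⟩]
      have hdeg : cdeg X b = cdeg K b + cdeg R b := by
        have := cdeg_eq_add_sdiff hKX b; rw [hXK] at this; exact this
      have h12X := cdeg_le_twelve X hX b
      have h12S := twelve_le_cdeg_add_cdeg_add_abandoned hσ hbS K V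
      have : cdeg R b ≤ cdeg V b + abandoned (stacking L s σ) K V b := by omega
      have hRb : (R.filter fun q => dist b q = 1).card = cdeg R b := rfl
      have hVb : (V.filter fun q => dist b q = 1).card = cdeg V b := rfl
      rw [hRb, hVb]
      exact_mod_cast this
    · have hnot : ¬ (b ∈ stacking L s σ ∧ ∃ a ∈ R, dist b a = 1) := fun h => htouch h.2
      rw [if_neg hnot, add_zero]
      have h0 : (R.filter fun q => dist b q = 1).card = 0 := by
        rw [Finset.card_eq_zero, Finset.filter_eq_empty_iff]
        intro a ha hd
        exact htouch ⟨a, ha, hd⟩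
      rw [h0]
      exact_mod_cast Nat.zero_le _
  · have hnot : ¬ (b ∈ stacking L s σ ∧ ∃ a ∈ R, dist b a = 1) := fun h => hbS h.1
    rw [if_neg hnot, add_zero, if_pos hbS]
    have : (0 : ℝ) ≤ (((V.filter fun q => dist b q = 1).card : ℕ) : ℝ) := Nat.cast_nonneg _
    linarith

open scoped Classical in
/-- **CUT HEAL, general form**: `D(K ∪ V) ≤ D(X) − Σ_{a ∈ R} halfDefect_X a + ½·(Σ_{V} #abandoned + Σ_{K ∩ S touching R} #abandoned + cross(K ∖ S, R))`. -/
theorem contactDeficiency_cut_heal_le_general (hσ : IsHaggSeq σ) (hX : ∀ p ∈ X, ∀ q ∈ X, p ≠ q → 1 ≤ dist p q) (hR : R ⊆ X)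
    (hV : Disjoint V (X \ R)) (hVS : ∀ v ∈ V, v ∈ stacking L s σ) :
    contactDeficiency ((X \ R) ∪ V) ≤ contactDeficiency X - ∑ a ∈ R, halfDefect X a +
      ((∑ v ∈ V, (abandoned (stacking L s σ) (X \ R) V v : ℝ)) +
        ∑ b ∈ (X \ R).filter (fun b => b ∈ stacking L s σ ∧ ∃ a ∈ R, dist b a = 1), (abandoned (stacking L s σ) (X \ R) V b : ℝ) +
        (crossCount ((X \ R).filter fun b => b ∉ stacking L s σ) R : ℝ)) / 2 := by
  classical
  rw [contactDeficiency_exchange_eq hR hV]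
  have hKX : X \ R ⊆ X := Finset.sdiff_subset
  have hXK : X \ (X \ R) = R := Finset.sdiff_sdiff_eq_self hR
  have hrem : ∑ a ∈ R, ((cdeg X a : ℝ) - (cdeg R a : ℝ) / 2 - 6) =
      (crossCount (X \ R) R : ℝ) / 2 - ∑ a ∈ R, halfDefect X a := by
    rw [crossCount_comm, crossCount_eq_sum, Nat.cast_sum, Finset.sum_div, ← Finset.sum_sub_distrib]
    refine Finset.sum_congr rfl fun a _ => ?_
    have hdeg : (cdeg X a : ℝ) = (cdeg (X \ R) a : ℝ) + (cdeg R a : ℝ) := by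
      have := cdeg_eq_add_sdiff hKX a; rw [hXK] at this; exact_mod_cast this
    have hKa : (((X \ R).filter fun q => dist a q = 1).card : ℕ) = cdeg (X \ R) a := rfl
    rw [hKa]
    unfold halfDefect
    rw [hdeg]; ring
  have hrefill := sum_refill_le hσ (X \ R) hVS (V := V)
  have hkiss := crossCount_removed_le_general hσ hX hR V (L := L) (s := s)
  rw [hrem]
  linarith

/-- After the surgery, `#abandoned(p)` is the number of touching `S`-sites of `p` that are VACANT in the new configuration `(X ∖ R) ∪ V`. -/
theorem abandoned_eq_vacant_after (S : Set E3) (X R V : Finset E3) (p : E3) :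
    abandoned S (X \ R) V p = {w | w ∈ S ∧ dist p w = 1 ∧ w ∉ (X \ R) ∪ V}.ncard := by
  unfold abandoned
  congr 1
  ext w
  simp only [Set.mem_setOf_eq, Finset.mem_union, not_or]

end General

/-! ## The site surgery -/

section Sites

variable {N : ℕ} {x : Fin N → E3} {L : E3 ≃ₗᵢ[ℝ] E3} {s : E3} {σ : ℤ → ℤ}

open scoped Classical in
/-- **THE SITE SURGERY.**  See the module docstring.  `R` = blockers (off-lattice balls within `< 1` of a site of `W`), `V` = vacant sites of `W`, both given
by their defining membership so that the consumer may name them as it likes. -/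
theorem exists_site_heal (hx : IsUnitPacking x) (hσ : IsHaggSeq σ) (W R V : Finset E3) (hW : ∀ w ∈ W, w ∈ stacking L s σ)
    (hRdef : ∀ a, a ∈ R ↔ a ∈ Set.range x ∧ a ∉ stacking L s σ ∧ ∃ w ∈ W, dist a w < 1)
    (hVdef : ∀ v, v ∈ V ↔ v ∈ W ∧ v ∉ Set.range x) :
    ∃ (N' : ℕ) (x' : Fin N' → E3), IsUnitPacking x' ∧
      Finset.univ.image x' = (Finset.univ.image x \ R) ∪ V ∧
      (∀ w ∈ W, w ∈ Set.range x') ∧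
      (∀ y, y ∈ Set.range x' ↔
        (y ∈ Set.range x ∧ (y ∈ stacking L s σ ∨ ∀ w ∈ W, 1 ≤ dist y w)) ∨ y ∈ W) ∧
      6 * (N' : ℝ) - (numContacts x' : ℝ) ≤ 6 * (N : ℝ) - (numContacts x : ℝ) - ∑ a ∈ R, halfDefect (Finset.univ.image x) a +
        ((∑ v ∈ V, (abandoned (stacking L s σ) (Finset.univ.image x \ R) V v : ℝ)) +
          ∑ b ∈ (Finset.univ.image x \ R).filter (fun b => b ∈ stacking L s σ ∧ ∃ a ∈ R, dist b a = 1),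
            (abandoned (stacking L s σ) (Finset.univ.image x \ R) V b : ℝ) +
          (crossCount ((Finset.univ.image x \ R).filter fun b => b ∉ stacking L s σ) R : ℝ)) / 2 ∧
      N ≤ N' + R.card := by
  classical
  set X : Finset E3 := Finset.univ.image x with hXdef
  set S : Set E3 := stacking L s σ with hSdef
  have hXsep := image_sep hx
  have hmemX : ∀ {a : E3}, a ∈ X ↔ a ∈ Set.range x := fun {a} => by
    rw [hXdef]; exact mem_image_univ_iff_mem_range
  have hRX : R ⊆ X := fun a ha => hmemX.2 ((hRdef a).1 ha).1
  have hVW : ∀ v ∈ V, v ∈ W := fun v hv => ((hVdef v).1 hv).1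
  have hVS : ∀ v ∈ V, v ∈ S := fun v hv => hW v (hVW v hv)
  have hVX : Disjoint V (X \ R) := by
    rw [Finset.disjoint_left]
    intro v hv hvK
    exact ((hVdef v).1 hv).2 (hmemX.1 (Finset.mem_sdiff.1 hvK).1)
  -- the new point set is `1`-separated
  have hsep : ∀ p ∈ (X \ R) ∪ V, ∀ q ∈ (X \ R) ∪ V, p ≠ q → 1 ≤ dist p q := by
    have hmixed : ∀ a ∈ X \ R, ∀ v ∈ V, 1 ≤ dist a v := by
      intro a ha v hv
      obtain ⟨haX, haR⟩ := Finset.mem_sdiff.1 ha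
      by_cases haS : a ∈ S
      · have hne : a ≠ v := fun h => ((hVdef v).1 hv).2 (hmemX.1 (h ▸ haX))
        exact one_le_dist_of_mem_stacking hσ haS (hVS v hv) hne
      · by_contra hlt
        push Not at hlt
        exact haR ((hRdef a).2 ⟨hmemX.1 haX, haS, v, hVW v hv, hlt⟩)
    intro p hp q hq hpq
    rcases Finset.mem_union.1 hp with hpK | hpV <;> rcases Finset.mem_union.1 hq with hqK | hqV
    · exact hXsep p (Finset.mem_sdiff.1 hpK).1 q (Finset.mem_sdiff.1 hqK).1 hpq
    · exact hmixed p hpK q hqV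
    · rw [dist_comm]; exact hmixed q hqK p hpV
    · exact one_le_dist_of_mem_stacking hσ (hVS p hpV) (hVS q hqV) hpq
  obtain ⟨x', hx', himg⟩ := exists_enum_of_separated ((X \ R) ∪ V) hsep
  have hmem' : ∀ {a : E3}, a ∈ Set.range x' ↔ a ∈ (X \ R) ∪ V := fun {a} => by
    have h := (mem_image_univ_iff_mem_range (f := x') (b := a)).symm
    rw [himg] at h
    exact h
  refine ⟨((X \ R) ∪ V).card, x', hx', himg, ?_, ?_, ?_, ?_⟩
  · -- every site of `W` is a ball afterwards
    intro w hw
    rw [hmem', Finset.mem_union]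
    by_cases hwx : w ∈ Set.range x
    · refine Or.inl (Finset.mem_sdiff.2 ⟨hmemX.2 hwx, fun hwR => ((hRdef w).1 hwR).2.1 (hW w hw)⟩)
    · exact Or.inr ((hVdef w).2 ⟨hw, hwx⟩)
  · -- the new range, exactly
    intro y
    rw [hmem', Finset.mem_union, Finset.mem_sdiff, hmemX, hRdef, hVdef]
    constructor
    · rintro (⟨hyx, hyR⟩ | ⟨hyW, -⟩)
      · refine Or.inl ⟨hyx, ?_⟩
        by_cases hyS : y ∈ S
        · exact Or.inl hyS
        · refine Or.inr fun w hw => ?_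
          by_contra hlt
          push Not at hlt
          exact hyR ⟨hyx, hyS, w, hw, hlt⟩
      · exact Or.inr hyW
    · rintro (⟨hyx, hyS | hyfar⟩ | hyW)
      · exact Or.inl ⟨hyx, fun h => h.2.1 hyS⟩
      · refine Or.inl ⟨hyx, ?_⟩
        rintro ⟨-, -, w, hw, hlt⟩
        exact absurd (hyfar w hw) (not_le.2 hlt)
      · by_cases hyx : y ∈ Set.range x
        · exact Or.inl ⟨hyx, fun h => h.2.1 (hW y hyW)⟩
        · exact Or.inr ⟨hyW, hyx⟩
  · -- the bill
    rw [← contactDeficiency_image_eq x hx.injective, ← contactDeficiency_image_eq x' hx'.injective, himg]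
    exact contactDeficiency_cut_heal_le_general hσ hXsep hRX hVX hVS
  · -- count
    have hN : N = X.card := (card_image_univ_eq x hx.injective).symm
    have h1 : (X \ R).card + R.card = X.card := Finset.card_sdiff_add_card_eq_card hRX
    have h2 : (X \ R).card ≤ ((X \ R) ∪ V).card := Finset.card_le_card Finset.subset_union_left
    omega

end Sites

end Summit.Ventures.Crystal3D.Theorems

end
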